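import Literature.Probability.FitznerVanDerHofstad2017.NobleJointTwoLevelIotaKit
import Literature.Probability.FitznerVanDerHofstad2017.NobleBoundsN1Cls22
import HarnessLib

/-!
# Fitzner–van der Hofstad (2017), §6.1: the class `(a,b) = (2,2)` of (6.4) at `N = 1` for the `ι`-event

[FvdH17] = R. Fitzner, R. van der Hofstad, *Mean-field behavior for nearest-neighbor percolation in `d > 10`*,
Electron. J. Probab. **22** (2017), no. 43, arXiv:1506.07977v2; §6.1 proof of Lemma 5.3 (pp. 58–59):
"Case `a ≥ 2`" of the `Ξ^ι` start, "Case `a ≥ 2` and `b = 2`" of the middle piece, "`b = 2`" of the last sausage.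

The class estimate `h2 (2,2)` of `NobleBoundsN1IotaReduce.tsum_ofReal_nobleXiIotaN_one_le_of_cls₁₂` for the event
`E ι x = NobleJointTwoLevelIota.jointWitIota ι x`:
`J(v−u) ℙ_p^{⊗2}(jointWitIota ∩ class (2,2)) ≤ Σ_κ 𝟙{v = u+e_κ} P^{ι,2}(u,w) Ā'^{κ,2,2}(u,w,t,z) P^{E,2}(t−x,z−x)`.
Scalar style (`NobleBoundsN1Cls22` pattern: `p = J(v−u)` stays a scalar on the middle factor).  For `u = e_ι` only
part `II` meets class `a = 2` and its start is `P^{ι,2}(e_ι,w)` (`NobleBoundsN1IotaStart`, rows `two_base_*`);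
for `u ≠ e_ι` both parts are live and are bounded by the two SUMMANDS of `P^{ι,2}(u,w)`
(`NobleJointTwoLevelIotaKit` §F) and added (`mul_le_blocks_of_parts`).  Middle `Ā'^{κ,2,2}` and end `P^{E,2}` are
the untwisted class-`(2,2)` letters of `NobleBoundsN1Cls22`.  Unconditional, every `d` and `p`.
-/

namespace Literature.Probability.FitznerVanDerHofstad2017

open Literature.Barriers.CriticalPhenomena Literature.Probability.Percolation Literature.Probability.LatticeModels
open Literature.Combinatorics.SimpleGraph _root_.SimpleGraph _root_.MeasureTheory
open Literature.Probability.FitznerVanDerHofstad2017.NobleBlocks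
open Literature.Probability.FitznerVanDerHofstad2017.NobleBlocks.LenIdx
open scoped ENNReal BigOperators

variable {d : ℕ}

namespace IotaCls22

/-! ### The upgraded line families -/

/-- Level `1`, class `b = 2`: `{v ↔ t}, {t ←2→ z}, {x ←1→ t}, {z ←1→ x}`. [cite: FitznerVanDerHofstad2017, §6.1 "b = 2" (arXiv:1506.07977v2 p. 59)] -/
def lv1 (v t z x : Site d) : Fin 4 → Set (BondConfig (Site d)) :=
  ![event (ge 0) v t, event (ge 2) t z, event (ge 1) x t, event (ge 1) z x]

/-- Part `II`, `u = e`, `w = 0`: `{0↔0}, {0 ←3→ e}, {e↔e}, {e↔e}, {z↔0}`. [cite: FitznerVanDerHofstad2017, §6.1 Case a ≥ 2 (arXiv:1506.07977v2 p. 59)] -/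
def linesB0 (e z v t x : Site d) : Fin 5 ⊕ Fin 4 → Set (BondConfig (Site d)) :=
  Sum.elim ![event (ge 0) 0 0, event (ge 3) 0 e, event (ge 0) e e, event (ge 0) e e, event (ge 0) z 0] (lv1 v t z x)

/-- Part `II`, `u = e`, `w ≠ 0`: `{0 ←1→ w}, {w ←2→ e}, {e↔e}, {e↔e}, {z↔w}`. [cite: FitznerVanDerHofstad2017, §6.1 Case a ≥ 2 (arXiv:1506.07977v2 p. 59)] -/
def linesBw (e w z v t x : Site d) : Fin 5 ⊕ Fin 4 → Set (BondConfig (Site d)) :=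
  Sum.elim ![event (ge 1) 0 w, event (ge 2) w e, event (ge 0) e e, event (ge 0) e e, event (ge 0) z w] (lv1 v t z x)

/-- Part `I`, `u ≠ e`, `w ≠ e`: `{0 ←3→ e}, {w ←1→ e}, {u ←2→ w}, {z↔w}, {e ←1→ u}`. [cite: FitznerVanDerHofstad2017, §6.1 Case a ≥ 2 (arXiv:1506.07977v2 p. 59)] -/
def linesIw (e u w z v t x : Site d) : Fin 5 ⊕ Fin 4 → Set (BondConfig (Site d)) :=
  Sum.elim ![event (ge 3) 0 e, event (ge 1) w e, event (ge 2) u w, event (ge 0) z w, event (ge 1) e u] (lv1 v t z x)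

/-- Part `I`, `u ≠ e`, `w = e`: `{0 ←3→ e}, {e↔e}, {e ←2→ u}, {z↔e}, {e ←2→ u}`. [cite: FitznerVanDerHofstad2017, §6.1 Case a ≥ 2 (arXiv:1506.07977v2 p. 59)] -/
def linesIe (e u z v t x : Site d) : Fin 5 ⊕ Fin 4 → Set (BondConfig (Site d)) :=
  Sum.elim ![event (ge 3) 0 e, event (ge 0) e e, event (ge 2) e u, event (ge 0) z e, event (ge 2) e u] (lv1 v t z x)

/-- Part `II`, `u ≠ e`, `w = 0`: `{0↔0}, {0 ←3→ e}, {e↔u}, {e↔u}, {z↔0}`. [cite: FitznerVanDerHofstad2017, §6.1 Case a ≥ 2 (arXiv:1506.07977v2 p. 59)] -/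
def linesF0 (e u z v t x : Site d) : Fin 5 ⊕ Fin 4 → Set (BondConfig (Site d)) :=
  Sum.elim ![event (ge 0) 0 0, event (ge 3) 0 e, event (ge 0) e u, event (ge 0) e u, event (ge 0) z 0] (lv1 v t z x)

/-- Part `II`, `u ≠ e`, `w ≠ 0`: `{0 ←1→ w}, {w ←1→ e}, {e↔u}, {e↔u}, {z↔w}`. [cite: FitznerVanDerHofstad2017, §6.1 Case a ≥ 2 (arXiv:1506.07977v2 p. 59)] -/
def linesFw (e u w z v t x : Site d) : Fin 5 ⊕ Fin 4 → Set (BondConfig (Site d)) :=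
  Sum.elim ![event (ge 1) 0 w, event (ge 1) w e, event (ge 0) e u, event (ge 0) e u, event (ge 0) z w] (lv1 v t z x)

/-- Finitarity of the level-`1` family. [cite: FitznerVanDerHofstad2017, §4.2 Def. 4.1 (arXiv:1506.07977v2 p. 35)] -/
theorem isFinitary_lv1 (v t z x : Site d) : ∀ j, IsFinitary (lv1 (d := d) v t z x j) := by
  intro j; fin_cases j
  exacts [isFinitary_event (ge 0) v t, isFinitary_event (ge 2) t z, isFinitary_event (ge 1) x t,
    isFinitary_event (ge 1) z x]

/-- [cite: FitznerVanDerHofstad2017, §4.2 Def. 4.1 (arXiv:1506.07977v2 p. 35)] -/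
theorem isFinitary_linesB0 (e z v t x : Site d) : ∀ i, IsFinitary (linesB0 (d := d) e z v t x i) := by
  rintro (i | j)
  · fin_cases i
    exacts [isFinitary_event (ge 0) 0 0, isFinitary_event (ge 3) 0 e, isFinitary_event (ge 0) e e,
      isFinitary_event (ge 0) e e, isFinitary_event (ge 0) z 0]
  · exact isFinitary_lv1 v t z x j

/-- [cite: FitznerVanDerHofstad2017, §4.2 Def. 4.1 (arXiv:1506.07977v2 p. 35)] -/
theorem isFinitary_linesBw (e w z v t x : Site d) : ∀ i, IsFinitary (linesBw (d := d) e w z v t x i) := by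
  rintro (i | j)
  · fin_cases i
    exacts [isFinitary_event (ge 1) 0 w, isFinitary_event (ge 2) w e, isFinitary_event (ge 0) e e,
      isFinitary_event (ge 0) e e, isFinitary_event (ge 0) z w]
  · exact isFinitary_lv1 v t z x j

/-- [cite: FitznerVanDerHofstad2017, §4.2 Def. 4.1 (arXiv:1506.07977v2 p. 35)] -/
theorem isFinitary_linesIw (e u w z v t x : Site d) : ∀ i, IsFinitary (linesIw (d := d) e u w z v t x i) := by
  rintro (i | j)
  · fin_cases i
    exacts [isFinitary_event (ge 3) 0 e, isFinitary_event (ge 1) w e, isFinitary_event (ge 2) u w,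
      isFinitary_event (ge 0) z w, isFinitary_event (ge 1) e u]
  · exact isFinitary_lv1 v t z x j

/-- [cite: FitznerVanDerHofstad2017, §4.2 Def. 4.1 (arXiv:1506.07977v2 p. 35)] -/
theorem isFinitary_linesIe (e u z v t x : Site d) : ∀ i, IsFinitary (linesIe (d := d) e u z v t x i) := by
  rintro (i | j)
  · fin_cases i
    exacts [isFinitary_event (ge 3) 0 e, isFinitary_event (ge 0) e e, isFinitary_event (ge 2) e u,
      isFinitary_event (ge 0) z e, isFinitary_event (ge 2) e u]
  · exact isFinitary_lv1 v t z x j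

/-- [cite: FitznerVanDerHofstad2017, §4.2 Def. 4.1 (arXiv:1506.07977v2 p. 35)] -/
theorem isFinitary_linesF0 (e u z v t x : Site d) : ∀ i, IsFinitary (linesF0 (d := d) e u z v t x i) := by
  rintro (i | j)
  · fin_cases i
    exacts [isFinitary_event (ge 0) 0 0, isFinitary_event (ge 3) 0 e, isFinitary_event (ge 0) e u,
      isFinitary_event (ge 0) e u, isFinitary_event (ge 0) z 0]
  · exact isFinitary_lv1 v t z x j

/-- [cite: FitznerVanDerHofstad2017, §4.2 Def. 4.1 (arXiv:1506.07977v2 p. 35)] -/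
theorem isFinitary_linesFw (e u w z v t x : Site d) : ∀ i, IsFinitary (linesFw (d := d) e u w z v t x i) := by
  rintro (i | j)
  · fin_cases i
    exacts [isFinitary_event (ge 1) 0 w, isFinitary_event (ge 1) w e, isFinitary_event (ge 0) e u,
      isFinitary_event (ge 0) e u, isFinitary_event (ge 0) z w]
  · exact isFinitary_lv1 v t z x j

/-! ### Facts of the class -/

/-- On `jointWitIota ∩ class (2,2)`: the side conditions, `u ≠ w`, and `z ≠ x`, `t ≠ x`.
[cite: FitznerVanDerHofstad2017, §6.1 "Case a = 2", "b = 2" (arXiv:1506.07977v2 pp. 58–59)] -/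
theorem facts {ι : Fin d × Bool} {x u v w z t : Site d} {ω : Fin 2 → BondConfig (Site d)}
    (hω : ω ∈ jointWitIota ι x u v w z t ∩ clsSet u w t z 2 2) : JWιSide u v w z t x ∧ u ≠ w ∧ z ≠ x ∧ t ≠ x := by
  have hs : JWιSide u v w z t x := by
    rcases hω.1 with h | h
    exacts [h.1, h.1]
  exact ⟨hs, ((mem_lineCls_two_iff u w 0 ω).1 hω.2.1).1, ne_and_ne_of_side_of_mem_lineCls hs (by decide) hω.2.2⟩

/-- The level-`1` upgrades of class `b = 2` on a configuration of the class. [cite: FitznerVanDerHofstad2017, §6.1 "b = 2" (arXiv:1506.07977v2 p. 59)] -/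
theorem up₁ {E : Set (Fin 2 → BondConfig (Site d))} {u v w z t x : Site d} {a : Fin 3} (hzx : z ≠ x) (htx : t ≠ x) :
    ∀ ω ∈ E ∩ clsSet u w t z a 2, ∀ (j : Fin 4) (K : Set (Sym2 (Site d))), K ⊆ ω 1 → (∀ e ∈ K, u ∉ e) →
      K ∈ jwLines₁ v t z x j → K ∈ lv1 v t z x j := by
  intro ω hω j K hK _ hL
  have h1 := (mem_lineCls_two_iff t z 1 ω).1 hω.2.2
  exact upgrade₁_two h1.1 h1.2 hzx htx j K hK hL

/-- A closed bond of `ω₀` is missed by every `K ⊆ ω₀`, in either orientation. [cite: FitznerVanDerHofstad2017, §6.1 Case a = 2 (arXiv:1506.07977v2 p. 59)] -/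
theorem notMem_of_subset {K ω₀ : BondConfig (Site d)} {a b : Site d} (hK : K ⊆ ω₀) (hb : s(a, b) ∉ ω₀) :
    s(a, b) ∉ K ∧ s(b, a) ∉ K :=
  ⟨fun h => hb (hK h), fun h => hb (hK (by rw [Sym2.eq_swap]; exact h))⟩

end IotaCls22

open IotaCls22

section

variable (p : unitInterval)

/-- **Class `(2,2)`, `u = e_ι`**: only part `II` is live; start `P^{ι,2}(e_ι,w)`.
[cite: FitznerVanDerHofstad2017, §6.1 proof of Lemma 5.3, Case a ≥ 2 with `u = e_ι` (arXiv:1506.07977v2 p. 59)] -/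
theorem jointWitIota_cls_two_two_of_eq {ι : Fin d × Bool} {u : Site d} (hu : u = stepVec ι) (x v w z t : Site d) :
    ENNReal.ofReal (bondJ d p (v - u)) * piPerc d p 2 (jointWitIota ι x u v w z t ∩ clsSet u w t z 2 2) ≤
      ∑ κ : Fin d × Bool, (if v = u + stepVec κ then (1 : ℝ≥0∞) else 0) *
        (blockPiota (Letters.perc d p) ι 2 u w * blockAbar' (Letters.perc d p) κ 2 2 u w t z *
          blockPE (Letters.perc d p) 2 (t - x) (z - x)) := by
  classical
  refine ofReal_bondJ_mul_le_sum_ite p u v _ _ fun κ hv => ?_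
  by_cases hne : (jointWitIota ι x u v w z t ∩ clsSet u w t z 2 2).Nonempty
  swap
  · rw [Set.not_nonempty_iff_eq_empty.1 hne, measure_empty, mul_zero]; exact zero_le
  obtain ⟨ω₀, hω₀⟩ := hne
  obtain ⟨-, huw, hzx, htx⟩ := facts hω₀
  rw [jointWitIota_inter_eq_of_I (jointWitIotaI_inter_clsSet_eq_empty_of_eq hu x v w z t (a := 2) (by decide) 2)]
  subst hu
  by_cases hw0 : w = 0
  · subst hw0
    have h3 := piPerc_inter_le_prod₃_of_witnessedι p (C := clsSet (stepVec ι) 0 t z 2 2)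
      (fun ω (hω : ω ∈ jointWitIotaII ι x (stepVec ι) v 0 z t) => hω.2.2.2.2.2)
      (linesB0 (stepVec ι) z v t x) (isFinitary_linesB0 _ z v t x) grpιII grpιII_adm
      (fun ω hω hlat i K hK _ hL hI _ => by
        fin_cases i
        · exact mem_openConnGe_zero_of_mem hL
        · exact mem_event_ge_three_zero_stepVec hlat hK hL (hI (Finset.notMem_empty _))
        · exact mem_openConnGe_zero_of_mem hL
        · exact mem_openConnGe_zero_of_mem hL
        · have hL' : K ∈ (openConn (0 : Site d) z : Set (BondConfig (Site d))) := hL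
          exact mem_openConnGe_zero_of_mem (SimpleGraph.Reachable.symm hL'))
      (up₁ hzx htx)
    refine mul_le_blocks_of_factors h3 ?_ ?_ ?_
    · exact piPerc_grp_le _ _ _ 0 ![Sum.inl 1] (by decide) (by decide) (by funext m; fin_cases m; rfl)
        (piPerc_iotaStart_two_base_zero_le_blockPiota p ι _)
    · exact mul_piPerc_grp_le _ _ _ _ 1 ![Sum.inr 0, Sum.inl 4] (by decide) (by decide)
        (by funext m; fin_cases m <;> rfl) (ofReal_mul_piPerc_mid_two_two_le_blockAbar' p hv 0 t z _ (by decide))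
    · exact piPerc_grp_le _ _ _ 2 ![Sum.inr 2, Sum.inr 1, Sum.inr 3] (by decide) (by decide)
        (by funext m; fin_cases m <;> rfl) (piPerc_end_two_le_blockPE p hzx htx _)
  · have h3 := piPerc_inter_le_prod₃_of_witnessedι p (C := clsSet (stepVec ι) w t z 2 2)
      (fun ω (hω : ω ∈ jointWitIotaII ι x (stepVec ι) v w z t) => hω.2.2.2.2.2)
      (linesBw (stepVec ι) w z v t x) (isFinitary_linesBw _ w z v t x) grpιII grpιII_adm
      (fun ω hω hlat i K hK _ hL hI _ => by
        have hwe : w ≠ stepVec ι := (sideII_of_mem hω.1).2.1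
        have hcl := notMem_of_subset hK ((mem_lineCls_two_iff (stepVec ι) w 0 ω).1 hω.2.1).2
        fin_cases i
        · exact mem_openConnGe_one_of_ne hL (Ne.symm hw0)
        · exact mem_openConnGe_two_of_notMem hL hwe hcl.2
        · exact mem_openConnGe_zero_of_mem hL
        · exact mem_openConnGe_zero_of_mem hL
        · have hL' : K ∈ (openConn w z : Set (BondConfig (Site d))) := hL
          exact mem_openConnGe_zero_of_mem (SimpleGraph.Reachable.symm hL'))
      (up₁ hzx htx)
    refine mul_le_blocks_of_factors h3 ?_ ?_ ?_
    · exact piPerc_grp_le _ _ _ 0 ![Sum.inl 0, Sum.inl 1] (by decide) (by decide)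
        (by funext m; fin_cases m <;> rfl) (piPerc_iotaStart_two_base_ne_le_blockPiota p ι w _)
    · exact mul_piPerc_grp_le _ _ _ _ 1 ![Sum.inr 0, Sum.inl 4] (by decide) (by decide)
        (by funext m; fin_cases m <;> rfl) (ofReal_mul_piPerc_mid_two_two_le_blockAbar' p hv w t z _ (by decide))
    · exact piPerc_grp_le _ _ _ 2 ![Sum.inr 2, Sum.inr 1, Sum.inr 3] (by decide) (by decide)
        (by funext m; fin_cases m <;> rfl) (piPerc_end_two_le_blockPE p hzx htx _)

/-- **Class `(2,2)`, `u ≠ e_ι`**: both parts are live; part `I ≤ τ_3(e_ι) P^{S,2}(u−e_ι,w−e_ι) · Ā' · P^E`,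
part `II ≤ (B_{1,1}(w,e_ι) + δ_{w,0} τ_3(e_ι)) ℙ(e_ι ⇔ u) · Ā' · P^E`, and the two summands add up to `P^{ι,2}(u,w)`.
[cite: FitznerVanDerHofstad2017, §6.1 proof of Lemma 5.3, Case a ≥ 2 with `u ≠ e_ι`; (4.69); App. B rows b ≥ 2 of P^{ι,b} (arXiv:1506.07977v2 pp. 44, 59, 73)] -/
theorem jointWitIota_cls_two_two_of_ne {ι : Fin d × Bool} {u : Site d} (hu : u ≠ stepVec ι) (x v w z t : Site d) :
    ENNReal.ofReal (bondJ d p (v - u)) * piPerc d p 2 (jointWitIota ι x u v w z t ∩ clsSet u w t z 2 2) ≤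
      ∑ κ : Fin d × Bool, (if v = u + stepVec κ then (1 : ℝ≥0∞) else 0) *
        (blockPiota (Letters.perc d p) ι 2 u w * blockAbar' (Letters.perc d p) κ 2 2 u w t z *
          blockPE (Letters.perc d p) 2 (t - x) (z - x)) := by
  classical
  refine ofReal_bondJ_mul_le_sum_ite p u v _ _ fun κ hv => ?_
  by_cases hne : (jointWitIota ι x u v w z t ∩ clsSet u w t z 2 2).Nonempty
  swap
  · rw [Set.not_nonempty_iff_eq_empty.1 hne, measure_empty, mul_zero]; exact zero_le
  obtain ⟨ω₀, hω₀⟩ := hne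
  obtain ⟨-, huw, hzx, htx⟩ := facts hω₀
  refine mul_le_blocks_of_parts (piPerc_jointWitIota_inter_le_add p ι x u v w z t _) ?_ ?_
    (summands_le_blockPiota_two (Letters.perc d p) ι u w)
  · -- part `I`
    by_cases hw : w = stepVec ι
    · subst hw
      have h3 := piPerc_inter_le_prod₃_of_witnessedι p (C := clsSet u (stepVec ι) t z 2 2)
        (fun ω (hω : ω ∈ jointWitIotaI ι x u v (stepVec ι) z t) => hω.2.2)
        (linesIe (stepVec ι) u z v t x) (isFinitary_linesIe _ u z v t x) grpιI grpιI_adm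
        (fun ω hω hlat i K hK _ hL hI _ => by
          have hcl := notMem_of_subset hK ((mem_lineCls_two_iff u (stepVec ι) 0 ω).1 hω.2.1).2
          fin_cases i
          · exact mem_event_ge_three_zero_stepVec hlat hK hL (hI (by decide))
          · exact mem_openConnGe_zero_of_mem hL
          · exact mem_openConnGe_two_of_notMem hL (Ne.symm hu) hcl.2
          · have hL' : K ∈ (openConn (stepVec ι) z : Set (BondConfig (Site d))) := hL
            exact mem_openConnGe_zero_of_mem (SimpleGraph.Reachable.symm hL')
          · exact mem_openConnGe_two_of_notMem hL (Ne.symm hu) hcl.2)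
        (up₁ hzx htx)
      refine mul_le_blocks_of_factors h3 ?_ ?_ ?_
      · exact piPerc_grp_le _ _ _ 0 ![Sum.inl 0, Sum.inl 2, Sum.inl 4] (by decide) (by decide)
          (by funext m; fin_cases m <;> rfl) (piPerc_iotaStartI_two_ne_eq_le p ι hu _ rfl)
      · exact mul_piPerc_grp_le _ _ _ _ 1 ![Sum.inr 0, Sum.inl 3] (by decide) (by decide)
          (by funext m; fin_cases m <;> rfl)
          (ofReal_mul_piPerc_mid_two_two_le_blockAbar' p hv (stepVec ι) t z _ (by decide))
      · exact piPerc_grp_le _ _ _ 2 ![Sum.inr 2, Sum.inr 1, Sum.inr 3] (by decide) (by decide)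
          (by funext m; fin_cases m <;> rfl) (piPerc_end_two_le_blockPE p hzx htx _)
    · have h3 := piPerc_inter_le_prod₃_of_witnessedι p (C := clsSet u w t z 2 2)
        (fun ω (hω : ω ∈ jointWitIotaI ι x u v w z t) => hω.2.2)
        (linesIw (stepVec ι) u w z v t x) (isFinitary_linesIw _ u w z v t x) grpιI grpιI_adm
        (fun ω hω hlat i K hK _ hL hI _ => by
          have hcl := notMem_of_subset hK ((mem_lineCls_two_iff u w 0 ω).1 hω.2.1).2
          fin_cases i
          · exact mem_event_ge_three_zero_stepVec hlat hK hL (hI (by decide))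
          · have hL' : K ∈ (openConn (stepVec ι) w : Set (BondConfig (Site d))) := hL
            exact mem_openConnGe_one_of_ne (SimpleGraph.Reachable.symm hL') hw
          · have hL' : K ∈ (openConn w u : Set (BondConfig (Site d))) := hL
            exact mem_openConnGe_two_of_notMem (SimpleGraph.Reachable.symm hL') huw hcl.1
          · have hL' : K ∈ (openConn w z : Set (BondConfig (Site d))) := hL
            exact mem_openConnGe_zero_of_mem (SimpleGraph.Reachable.symm hL')
          · exact mem_openConnGe_one_of_ne hL (Ne.symm hu))
        (up₁ hzx htx)
      refine mul_le_blocks_of_factors h3 ?_ ?_ ?_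
      · exact piPerc_grp_le _ _ _ 0 ![Sum.inl 0, Sum.inl 4, Sum.inl 2, Sum.inl 1] (by decide) (by decide)
          (by funext m; fin_cases m <;> rfl) (piPerc_iotaStartI_two_ne_ne_le p ι hu hw _)
      · exact mul_piPerc_grp_le _ _ _ _ 1 ![Sum.inr 0, Sum.inl 3] (by decide) (by decide)
          (by funext m; fin_cases m <;> rfl) (ofReal_mul_piPerc_mid_two_two_le_blockAbar' p hv w t z _ (by decide))
      · exact piPerc_grp_le _ _ _ 2 ![Sum.inr 2, Sum.inr 1, Sum.inr 3] (by decide) (by decide)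
          (by funext m; fin_cases m <;> rfl) (piPerc_end_two_le_blockPE p hzx htx _)
  · -- part `II`
    by_cases hw0 : w = 0
    · subst hw0
      have h3 := piPerc_inter_le_prod₃_of_witnessedι p (C := clsSet u 0 t z 2 2)
        (fun ω (hω : ω ∈ jointWitIotaII ι x u v 0 z t) => hω.2.2.2.2.2)
        (linesF0 (stepVec ι) u z v t x) (isFinitary_linesF0 _ u z v t x) grpιII grpιII_adm
        (fun ω hω hlat i K hK _ hL hI _ => by
          fin_cases i
          · exact mem_openConnGe_zero_of_mem hL
          · exact mem_event_ge_three_zero_stepVec hlat hK hL (hI (Finset.notMem_empty _))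
          · exact mem_openConnGe_zero_of_mem hL
          · exact mem_openConnGe_zero_of_mem hL
          · have hL' : K ∈ (openConn (0 : Site d) z : Set (BondConfig (Site d))) := hL
            exact mem_openConnGe_zero_of_mem (SimpleGraph.Reachable.symm hL'))
        (up₁ hzx htx)
      refine mul_le_blocks_of_factors h3 ?_ ?_ ?_
      · exact piPerc_grp_le _ _ _ 0 ![Sum.inl 1, Sum.inl 2, Sum.inl 3] (by decide) (by decide)
          (by funext m; fin_cases m <;> rfl) (piPerc_iotaStartII_two_far_zero_le p ι hu _ rfl)
      · exact mul_piPerc_grp_le _ _ _ _ 1 ![Sum.inr 0, Sum.inl 4] (by decide) (by decide)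
          (by funext m; fin_cases m <;> rfl) (ofReal_mul_piPerc_mid_two_two_le_blockAbar' p hv 0 t z _ (by decide))
      · exact piPerc_grp_le _ _ _ 2 ![Sum.inr 2, Sum.inr 1, Sum.inr 3] (by decide) (by decide)
          (by funext m; fin_cases m <;> rfl) (piPerc_end_two_le_blockPE p hzx htx _)
    · have h3 := piPerc_inter_le_prod₃_of_witnessedι p (C := clsSet u w t z 2 2)
        (fun ω (hω : ω ∈ jointWitIotaII ι x u v w z t) => hω.2.2.2.2.2)
        (linesFw (stepVec ι) u w z v t x) (isFinitary_linesFw _ u w z v t x) grpιII grpιII_adm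
        (fun ω hω hlat i K hK _ hL hI _ => by
          have hwe : w ≠ stepVec ι := (sideII_of_mem hω.1).2.1
          fin_cases i
          · exact mem_openConnGe_one_of_ne hL (Ne.symm hw0)
          · exact mem_openConnGe_one_of_ne hL hwe
          · exact mem_openConnGe_zero_of_mem hL
          · exact mem_openConnGe_zero_of_mem hL
          · have hL' : K ∈ (openConn w z : Set (BondConfig (Site d))) := hL
            exact mem_openConnGe_zero_of_mem (SimpleGraph.Reachable.symm hL'))
        (up₁ hzx htx)
      refine mul_le_blocks_of_factors h3 ?_ ?_ ?_
      · exact piPerc_grp_le _ _ _ 0 ![Sum.inl 0, Sum.inl 1, Sum.inl 2, Sum.inl 3] (by decide) (by decide)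
          (by funext m; fin_cases m <;> rfl) (piPerc_iotaStartII_two_far_ne_le p ι hu w _ rfl)
      · exact mul_piPerc_grp_le _ _ _ _ 1 ![Sum.inr 0, Sum.inl 4] (by decide) (by decide)
          (by funext m; fin_cases m <;> rfl) (ofReal_mul_piPerc_mid_two_two_le_blockAbar' p hv w t z _ (by decide))
      · exact piPerc_grp_le _ _ _ 2 ![Sum.inr 2, Sum.inr 1, Sum.inr 3] (by decide) (by decide)
          (by funext m; fin_cases m <;> rfl) (piPerc_end_two_le_blockPE p hzx htx _)

/-- **[FvdH17] §6.1, Case `a = 2, b = 2` of (6.4) at `N = 1` for the `ι`-event.**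
`J(v−u) ℙ_p^{⊗2}(jointWitIota ι x u v w z t ∩ class (2,2)) ≤ Σ_κ 𝟙{v = u+e_κ} P^{ι,2}(u,w) Ā'^{κ,2,2}(u,w,t,z) P^{E,2}(t−x,z−x)`.
[cite: FitznerVanDerHofstad2017, §6.1 proof of Lemma 5.3, "Case a ≥ 2", "Case a ≥ 2 and b = 2", "b = 2" (arXiv:1506.07977v2 pp. 58–59)] -/
theorem jointWitIota_cls_two_two (ι : Fin d × Bool) (x u v w z t : Site d) :
    ENNReal.ofReal (bondJ d p (v - u)) * piPerc d p 2 (jointWitIota ι x u v w z t ∩ clsSet u w t z 2 2) ≤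
      ∑ κ : Fin d × Bool, (if v = u + stepVec κ then (1 : ℝ≥0∞) else 0) *
        (blockPiota (Letters.perc d p) ι 2 u w * blockAbar' (Letters.perc d p) κ 2 2 u w t z *
          blockPE (Letters.perc d p) 2 (t - x) (z - x)) := by
  by_cases hu : u = stepVec ι
  exacts [jointWitIota_cls_two_two_of_eq p hu x v w z t, jointWitIota_cls_two_two_of_ne p hu x v w z t]

end

end Literature.Probability.FitznerVanDerHofstad2017
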